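import Literature.AlgebraicGeometry.Modules.BoxTensorAffineSections
import Literature.AlgebraicGeometry.Modules.ModuleCechComplex
import HarnessLib

/-!
# `Γ(U ×_S V, E ⊠ F) ≃ Γ(U, E) ⊗_A Γ(V, F)` in the dialect of the module Čech complex (`SecMod`)

Layer `Literature/AlgebraicGeometry/Modules` (one construction, 0 named facts, no instance, no notation). The comparison
isomorphism `boxTensorSectionsEquiv` of `Modules/BoxTensorAffineSections` (Görtz–Wedhorn I Prop. 4.17 + Prop. 7.24 (2) +
Cor. 7.19 (4): `Γ(Spec(A′ ⊗_R B′), M~ ⊠ N~) = M ⊗_R N`), TRANSPORTED to the typing the module Čech complexes consume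
(`Modules/ModuleCechComplex`: `SecMod L ρ U = Γ(L, U)` as an `A`-module through a ring map `ρ : A → Γ(X, ⊤)`,
`Modules.cechComplex 𝓥 L ρ` = the ordered Čech complex of the system `s ↦ SecMod L ρ (V_s)`). Setting: an AFFINE base
`S`, a ring `A` with `φ : A ≃+* Γ(S, ⊤)` (e.g. `A = Γ(S, ⊤)`, `φ = 1`, or `S = Spec A`), a cartesian square
`p ≫ i_X = q ≫ i_Y` (`Z = X ×_S Y`), affine opens `U ⊆ X`, `V ⊆ Y`, `W = p⁻¹U ∩ q⁻¹V`, quasi-coherent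
(affine-localizing) `E`, `F`; the three section modules are `A`-modules through `overRingHom f φ = f♯ ∘ φ : A → Γ(·, ⊤)`
for `f = i_X`, `i_Y`, `p ≫ i_X`:

* `overRingHom`, `toSections_overRingHom_smul` — the structure maps and their compatibility with `Scheme.Hom.appLE`;
* **`boxTensorSecModEquiv : SecMod (E ⊠ F) ρ_Z W ≃ₗ[A] SecMod E ρ_X U ⊗_A SecMod F ρ_Y V`** (:= `boxTensorSectionsEquiv` at
  the `SecMod.instModule` structures — NOT a second construction), `boxTensorSecModEquiv_symm_tmul`;
* **`boxTensorSecModEquiv_natural`** — compatibility with the `A`-linear restrictions `SecMod.res` to smaller affine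
  opens `U' ⊆ U`, `V' ⊆ V`, `W' = p⁻¹U' ∩ q⁻¹V'` (from `boxTensorSectionsEquiv_natural`), the form in which the
  isomorphisms commute with the Čech differentials of `Modules.cechComplex`.

Library only (cell `pub-hodge-ring2`, count-neutral); proves nothing about any crux, route or conjecture.

## References

* U. Görtz, T. Wedhorn, *Algebraic Geometry I: Schemes*, 2nd ed. (2020): Prop. 4.17, Cor. 7.19 (4) (7.10.2), Prop. 7.24
  (2), Rem. 7.25. [GortzWedhorn2020]
* U. Görtz, T. Wedhorn, *Algebraic Geometry II: Cohomology of Schemes* (2023), Def. 21.68 (p. 180) (the Čech complex of a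
  module over a base ring). [GortzWedhorn2023]
* The Stacks Project, Tag 01I8 (1), Tag 0BEC. [StacksProject]
-/

noncomputable section

set_option backward.isDefEq.respectTransparency false -- `Scheme.Modules` is not reducible (as in Mathlib)

open CategoryTheory AlgebraicGeometry TopologicalSpace Opposite TensorProduct

universe u

namespace Literature.AlgebraicGeometry.Modules

variable {X Y Z S : Scheme.{u}} {p : Z ⟶ X} {q : Z ⟶ Y} {iX : X ⟶ S} {iY : Y ⟶ S}
  {U U' : X.Opens} {V V' : Y.Opens} {W W' : Z.Opens} {E : X.Modules} {F : Y.Modules} {A : Type u} [CommRing A]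

/-- **The structure map `A → Γ(X, 𝒪_X)` of an `S`-scheme `f : X → S` over a ring `A ≅ Γ(S, 𝒪_S)`**: `f♯ ∘ φ` (the `ρ`
of `Modules/ModuleCechComplex` for schemes over an affine base `S`, `Γ(S, ⊤) ≅ A`). [cite: GortzWedhorn2023, Def. 21.68 (p. 180)] -/
abbrev overRingHom (f : X ⟶ S) (φ : A ≃+* Γ(S, ⊤)) : A →+* Γ(X, ⊤) :=
  f.appTop.hom.comp φ.toRingHom

/-- `U ≤ f⁻¹(⊤)`. [folklore] -/
private theorem le_preimage_top (f : X ⟶ S) (U : X.Opens) : U ≤ f ⁻¹ᵁ ⊤ := le_top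

/-- The `A`-module structure of `SecMod L (overRingHom f φ) U` acts through `f♯ : Γ(S, ⊤) → Γ(X, U)`:
`c • m = f♯(φ c)|_U • m` (`SecMod.smul_def`, `toSections`). [cite: GortzWedhorn2023, Def. 21.68 (p. 180)] -/
theorem toSections_overRingHom_smul (f : X ⟶ S) (φ : A ≃+* Γ(S, ⊤)) (L : X.Modules) (U : X.Opens) (c : A)
    (m : SecMod L (overRingHom f φ) U) :
    SecMod.val (c • m) = f.appLE ⊤ U (le_preimage_top f U) (φ c) • SecMod.val m := by
  rw [SecMod.smul_def, toSections, Scheme.Hom.appLE]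
  rfl

section

variable [IsAffine S] (H : IsPullback p q iX iY) (hU : IsAffineOpen U) (hV : IsAffineOpen V)
  (hU' : IsAffineOpen U') (hV' : IsAffineOpen V') (hW : W = p ⁻¹ᵁ U ⊓ q ⁻¹ᵁ V) (hW' : W' = p ⁻¹ᵁ U' ⊓ q ⁻¹ᵁ V')
  (hE : IsAffineLocalizing E) (hF : IsAffineLocalizing F) (φ : A ≃+* Γ(S, ⊤))

/-- **`Γ(U ×_S V, E ⊠ F) ≃ₗ[A] Γ(U, E) ⊗_A Γ(V, F)` in the `SecMod` dialect**: for an affine base `S` with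
`φ : A ≃ Γ(S, ⊤)`, a cartesian square `Z = X ×_S Y`, affine `U ⊆ X`, `V ⊆ Y`, `W = p⁻¹U ∩ q⁻¹V` and quasi-coherent
`E`, `F`, the isomorphism `boxTensorSectionsEquiv` (Görtz–Wedhorn I Prop. 4.17, Prop. 7.24 (2), Cor. 7.19 (4)) read on
the `A`-modules `SecMod · (f♯ ∘ φ) ·` of `Modules/ModuleCechComplex`. [cite: GortzWedhorn2020, Cor. 7.19 (4) and Prop. 7.24 (2)]
[cite: GortzWedhorn2023, Def. 21.68 (p. 180)] -/
def boxTensorSecModEquiv :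
    SecMod (boxTensor p q E F) (overRingHom (p ≫ iX) φ) W ≃ₗ[A]
      SecMod E (overRingHom iX φ) U ⊗[A] SecMod F (overRingHom iY φ) V :=
  letI : Module A Γ(E, U) := inferInstanceAs (Module A (SecMod E (overRingHom iX φ) U))
  letI : Module A Γ(F, V) := inferInstanceAs (Module A (SecMod F (overRingHom iY φ) V))
  letI : Module A Γ(boxTensor p q E F, W) :=
    inferInstanceAs (Module A (SecMod (boxTensor p q E F) (overRingHom (p ≫ iX) φ) W))
  boxTensorSectionsEquiv H (isAffineOpen_top S) hU hV (le_preimage_top iX U) (le_preimage_top iY V) hW hE hF φ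
    (fun c m => toSections_overRingHom_smul iX φ E U c m) (fun c n => toSections_overRingHom_smul iY φ F V c n)
    (fun c s => toSections_overRingHom_smul (p ≫ iX) φ (boxTensor p q E F) W c s)

/-- The inverse on pure tensors: `e⁻¹(m ⊗ n) = η_p(m)|_W ⊗ η_q(n)|_W` (underlying sections).
[cite: GortzWedhorn2020, Cor. 7.19 (4) and Prop. 7.24 (2)] -/
theorem boxTensorSecModEquiv_symm_tmul (m : SecMod E (overRingHom iX φ) U) (n : SecMod F (overRingHom iY φ) V) :
    SecMod.val ((boxTensorSecModEquiv H hU hV hW hE hF φ).symm (m ⊗ₜ n)) =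
      tmulSection ((Scheme.Modules.pullback p).obj E) ((Scheme.Modules.pullback q).obj F) W
        (unitSectionLE p E (le_preimage_left_of_eq_inf hW) (SecMod.val m))
        (unitSectionLE q F (le_preimage_right_of_eq_inf hW) (SecMod.val n)) :=
  rfl

/-- **Naturality against the Čech restrictions**: for `U' ⊆ U`, `V' ⊆ V`, `W' = p⁻¹U' ∩ q⁻¹V' ⊆ W`,
`e'(s|_{W'}) = (res_E ⊗ res_F)(e(s))` with the `A`-linear restrictions `SecMod.res` of `Modules/ModuleCechComplex` — so the
isomorphisms commute with the differentials of the module Čech complexes. [cite: GortzWedhorn2020, Rem. 7.25]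
[cite: GortzWedhorn2023, Def. 21.68 (p. 180)] -/
theorem boxTensorSecModEquiv_natural (kU : U' ≤ U) (kV : V' ≤ V) (j : W' ≤ W)
    (s : SecMod (boxTensor p q E F) (overRingHom (p ≫ iX) φ) W) :
    boxTensorSecModEquiv H hU' hV' hW' hE hF φ (SecMod.res (boxTensor p q E F) (overRingHom (p ≫ iX) φ) j s) =
      TensorProduct.map (SecMod.res E (overRingHom iX φ) kU) (SecMod.res F (overRingHom iY φ) kV)
        (boxTensorSecModEquiv H hU hV hW hE hF φ s) := by
  letI : Module A Γ(E, U) := inferInstanceAs (Module A (SecMod E (overRingHom iX φ) U))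
  letI : Module A Γ(F, V) := inferInstanceAs (Module A (SecMod F (overRingHom iY φ) V))
  letI : Module A Γ(boxTensor p q E F, W) :=
    inferInstanceAs (Module A (SecMod (boxTensor p q E F) (overRingHom (p ≫ iX) φ) W))
  letI : Module A Γ(E, U') := inferInstanceAs (Module A (SecMod E (overRingHom iX φ) U'))
  letI : Module A Γ(F, V') := inferInstanceAs (Module A (SecMod F (overRingHom iY φ) V'))
  letI : Module A Γ(boxTensor p q E F, W') :=
    inferInstanceAs (Module A (SecMod (boxTensor p q E F) (overRingHom (p ≫ iX) φ) W'))
  exact boxTensorSectionsEquiv_natural H (isAffineOpen_top S) hU hV hU' hV' (le_preimage_top iX U)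
    (le_preimage_top iY V) hW (le_preimage_top iX U') (le_preimage_top iY V') hW' hE hF φ
    (fun c m => toSections_overRingHom_smul iX φ E U c m) (fun c n => toSections_overRingHom_smul iY φ F V c n)
    (fun c s => toSections_overRingHom_smul (p ≫ iX) φ (boxTensor p q E F) W c s)
    (fun c m => toSections_overRingHom_smul iX φ E U' c m) (fun c n => toSections_overRingHom_smul iY φ F V' c n)
    (fun c s => toSections_overRingHom_smul (p ≫ iX) φ (boxTensor p q E F) W' c s) kU kV j
    (SecMod.res E (overRingHom iX φ) kU) (fun m => rfl) (SecMod.res F (overRingHom iY φ) kV) (fun n => rfl) s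

end

end Literature.AlgebraicGeometry.Modules

end
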